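import Mathlib
import Summits.ResolutionOfSingularities.ResolutionOfSingularities.Theorems.SyzygyFlatteningHigherRankTerminationLocAt
import Literature.AlgebraicGeometry.Resolution.SyzygySheaf
import Literature.AlgebraicGeometry.Resolution.ModuleBlowup
import HarnessLib

/-!
# A minimal chart datum localises along a coarsening: `stub_localizedDatum`

Crux `HigherRankTermination` (stmt-ResolutionOfSingularities-17045), line `birth`, registered
stub `stub_localizedDatum`.

Setting: `k ⊆ O ≤ O₁` valuation rings of `K`, a model `B ⊆ O` with `Frac B = K`, and
`B₁ := locAt O₁ B`, the localisation of `B` at the centre of `O₁` realised in `K`, with the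
non-regular locus assumed to localise: `J B₁ = (J B) B₁` (hypothesis). A chart datum over `B` —
a finite free resolution `(b, d, ε)` of `B ⧸ J B`, an embedding `ι` with torsion cokernel of the
`n`-th syzygy module `Ω = range (d (n - 1))` into `B^r`, and an `r`-tuple `x` of syzygies with
`det (ι x) ≠ 0` and `O`-minimal (`det (ι g') / det (ι x) ∈ O` for all `g'`) — is pushed to `B₁`:

* (0) `B₁` is the localisation of `B` at the submonoid `M` of elements of `B` that become units
  in `B₁` (`IsLocalization`, three defining conditions from `mem_locAt_iff` / `inv_mem_locAt`);
  hence `B₁` is `B`-flat (`IsLocalization.flat`).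
* (1) `B ⧸ J B → B₁ ⧸ J B₁ = B₁ ⧸ (J B) B₁` is the localisation of the module `B ⧸ J B` at `M`
  (Mathlib `Submodule.toLocalizedQuotient'`, `Ideal.localized'_eq_map`).
* (2) The base-changed matrices resolve `B₁ ⧸ J B₁` (`FreeResolution.baseChange`), and
  (3) the `n`-th syzygy module localises (`isLocalizedModule_syzygyMap`), so the embedding
  extends `B₁`-linearly (`localizedFraming`); it stays injective with torsion cokernel because
  framings localise (`IsFraming.localizedFraming`) and `Ω₁ ⊆ B₁^{b n}` is torsion free.
* (4) `x₁ := x / 1`: the `K`-valued matrices of `ι₁ x₁` and `ι x` coincide, so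
  `det (ι₁ x₁) = det (ι x) ≠ 0`; (5) every `r`-tuple `g'` of `Ω₁` is `(m_i / s_i)_i` with
  `s_i ∈ M`, so `det (ι₁ g') = det (ι m) · (∏ s_i)⁻¹` (`Matrix.det_mul_column`) and
  `det (ι₁ g') / det (ι₁ x₁) = (det (ι m) / det (ι x)) · ∏ s_i⁻¹ ∈ O · B₁ ⊆ O₁`.
* (6) `locAt O₁ (B₁[det ι₁ g₁ / det ι₁ x₁]) = locAt O₁ (B[det ι g / det ι x])`: `⊇` by
  monotonicity, `⊆` because the new ratios are old ratios times units of `B₁`, followed by the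
  idempotence `locAt_locAt`.

All of this is the printed remark "localisation of a finite free resolution is a finite free
resolution of the localised module" (Matsumura §19, after Lemma 4) together with Villamayor's
"the representatives of `[[M]]` patch" (Villamayor 2006, 3.4).
-/

noncomputable section

-- single-problem summit: the doubled namespace component `ResolutionOfSingularities` is forced
set_option linter.dupNamespace false

namespace Summit.ResolutionOfSingularities.ResolutionOfSingularities.Theorems.SyzygyFlattening

open Function Literature.AlgebraicGeometry.Resolution

/-! ## Two elementary lemmas -/

/-- Scaling the rows of a square matrix over a field: if `c i * A i j = B i j` with all `c i ≠ 0`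
then `det A = det B * (∏ c i)⁻¹` (Mathlib `Matrix.det_mul_column`). [folklore] -/
theorem det_eq_det_mul_prod_inv {K : Type*} [Field K] {r : ℕ} (c : Fin r → K)
    (A B : Matrix (Fin r) (Fin r) K) (h : ∀ i j, c i * A i j = B i j) (hc : ∀ i, c i ≠ 0) :
    A.det = B.det * (∏ i, c i)⁻¹ := by
  have hB : B = Matrix.of fun i j => c i * A i j := by
    ext i j
    exact (h i j).symm
  rw [eq_mul_inv_iff_mul_eq₀ (Finset.prod_ne_zero_iff.mpr fun i _ => hc i), hB,
    Matrix.det_mul_column]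
  exact mul_comm _ _

variable {k K : Type} [Field k] [Field K] [Algebra k K]

/-- **Comparing two charts after localising at a centre.** If `B ≤ B₁ ≤ locAt O₁ B`, the old
ratios `R₀ ⊆ O₁` are among the new ones `R₁`, and every new ratio is an old ratio times an
element of `B₁`, then `B₁[R₁]` and `B[R₀]` have the same localisation at the centre of `O₁`
(monotonicity and idempotence of `locAt O₁`). [folklore] -/
theorem locAt_adjoin_union_eq (O₁ : ValuationSubring K) (hk₁ : ∀ c : k, algebraMap k K c ∈ O₁)
    {B B₁ : Subalgebra k K} {R₀ R₁ : Set K} (hBB₁ : B ≤ B₁) (hB₁ : B₁ ≤ locAt O₁ B)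
    (hBO : B.toSubring ≤ O₁.toSubring) (hR₀ : ∀ y ∈ R₀, y ∈ O₁) (h₀₁ : R₀ ⊆ R₁)
    (h₁₀ : R₁ ⊆ {y : K | ∃ a ∈ R₀, ∃ t ∈ B₁, y = a * t}) :
    locAt O₁ (Algebra.adjoin k ((B₁ : Set K) ∪ R₁)) =
      locAt O₁ (Algebra.adjoin k ((B : Set K) ∪ R₀)) := by
  apply le_antisymm
  · have hBC : B ≤ Algebra.adjoin k ((B : Set K) ∪ R₀) := fun y hy =>
      Algebra.subset_adjoin (Or.inl hy)
    have hC : (Algebra.adjoin k ((B : Set K) ∪ R₀)).toSubring ≤ O₁.toSubring :=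
      adjoin_toSubring_le_valuationSubring O₁ hk₁
        (Set.union_subset (fun y hy => hBO hy) fun y hy => hR₀ y hy)
    rw [← locAt_locAt O₁ _ hC]
    refine locAt_mono O₁ (Algebra.adjoin_le ?_)
    rintro y (hy | hy)
    · exact locAt_mono O₁ hBC (hB₁ hy)
    · obtain ⟨a, ha, t, ht, rfl⟩ := h₁₀ hy
      exact mul_mem (self_le_locAt O₁ _ (Algebra.subset_adjoin (Or.inr ha)))
        (locAt_mono O₁ hBC (hB₁ ht))
  · refine locAt_mono O₁ (Algebra.adjoin_mono ?_)
    rintro y (hy | hy)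
    · exact Or.inl (hBB₁ hy)
    · exact Or.inr (h₀₁ hy)

/-! ## The algebraic heart: base change of a chart datum along a localisation -/

/-- **Base change of a chart datum along a localisation `R → S = M⁻¹R`** (abstract form).
Given a finite free resolution `(b, d, ε)` of `R ⧸ J`, an injective `ι : Ω = range (d n) → R^r`
with torsion cokernel (`R`, `S` domains) and `J₁ = J S`: the base-changed matrices `d₁` resolve
`S ⧸ J₁` (flat base change, `FreeResolution.baseChange`, the module `R ⧸ J → S ⧸ J S` being the
localisation at `M`), the syzygy module localises (`f : Ω → Ω₁ = range (d₁ n)`,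
`isLocalizedModule_syzygyMap`), `ι` extends to an injective `ι₁ : Ω₁ → S^r` with torsion
cokernel (`localizedFraming`, `IsFraming.localizedFraming`), `ι₁ ∘ f = ι` entrywise — so the
`K`-valued maximal minors of `f ∘ g` and `g` agree — and every `r`-tuple `g'` of `Ω₁` is
`(m_i / s_i)` with `s_i ∈ M`, whence `det (ι₁ g') = det (ι m) · (∏ s_i)⁻¹` in `K`.
[cite: Matsumura1987, §19 (after Lemma 4)] -/
theorem localizedDatum_alg {R S L : Type*} [CommRing R] [IsDomain R] [CommRing S] [IsDomain S]
    [Field L] [Algebra R S] [Algebra R L] [Algebra S L] [IsScalarTower R S L]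
    (M : Submonoid R) [IsLocalization M S] (hMK : ∀ s ∈ M, algebraMap R L s ≠ 0)
    (J : Ideal R) (J₁ : Ideal S) (hJ : J₁ = J.map (algebraMap R S)) (n : ℕ) (b : ℕ → ℕ)
    (d : (i : ℕ) → ((Fin (b (i + 1)) → R) →ₗ[R] (Fin (b i) → R)))
    (ε : (Fin (b 0) → R) →ₗ[R] (R ⧸ J)) (r : ℕ)
    (ι : ↥(LinearMap.range (d n)) →ₗ[R] (Fin r → R))
    (hε : Function.Surjective ε) (h0 : Function.Exact (d 0) ε)
    (hs : ∀ i : ℕ, Function.Exact (d (i + 1)) (d i)) (hι : Function.Injective ι)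
    (htors : ∀ z : Fin r → R, ∃ a : R, a ≠ 0 ∧ a • z ∈ LinearMap.range ι) :
    ∃ (d₁ : (i : ℕ) → ((Fin (b (i + 1)) → S) →ₗ[S] (Fin (b i) → S)))
      (ε₁ : (Fin (b 0) → S) →ₗ[S] (S ⧸ J₁))
      (ι₁ : ↥(LinearMap.range (d₁ n)) →ₗ[S] (Fin r → S))
      (f : ↥(LinearMap.range (d n)) →ₗ[R] ↥(LinearMap.range (d₁ n))),
      (Function.Surjective ε₁ ∧ Function.Exact (d₁ 0) ε₁ ∧
          (∀ i : ℕ, Function.Exact (d₁ (i + 1)) (d₁ i)) ∧ Function.Injective ι₁ ∧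
          (∀ z : Fin r → S, ∃ a : S, a ≠ 0 ∧ a • z ∈ LinearMap.range ι₁)) ∧
      (∀ g : Fin r → ↥(LinearMap.range (d n)),
        Matrix.det (Matrix.of fun i j => algebraMap S L (ι₁ (f (g i)) j)) =
          Matrix.det (Matrix.of fun i j => algebraMap R L (ι (g i) j))) ∧
      (∀ g' : Fin r → ↥(LinearMap.range (d₁ n)),
        ∃ (m : Fin r → ↥(LinearMap.range (d n))) (s : Fin r → R), (∀ i, s i ∈ M) ∧
          Matrix.det (Matrix.of fun i j => algebraMap S L (ι₁ (g' i) j)) =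
            Matrix.det (Matrix.of fun i j => algebraMap R L (ι (m i) j)) *
              (∏ i, algebraMap R L (s i))⁻¹) := by
  subst hJ
  haveI : Module.Flat R S := IsLocalization.flat S M
  -- (1) the resolved module localises: `R ⧸ J → S ⧸ J S` is the localisation at `M`
  rw [← Ideal.localized'_eq_map S M J]
  set φ : (R ⧸ J) →ₗ[R] (S ⧸ Submodule.localized' S M (Algebra.linearMap R S) J) :=
    Submodule.toLocalizedQuotient' S M (Algebra.linearMap R S) J with hφdef
  haveI hφM : IsLocalizedModule M φ :=
    IsLocalizedModule.toLocalizedQuotient' S M (Algebra.linearMap R S) J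
  have hφ : IsBaseChange S φ := (isLocalizedModule_iff_isBaseChange M S φ).1 hφM
  -- (2) the resolution and its flat base change
  set F : FreeResolution R (R ⧸ J) := ⟨b, d, ε, hε, h0, hs⟩ with hFdef
  -- (3) the syzygy module localises; the localised framing
  haveI hf : IsLocalizedModule M (F.syzygyMap S φ hφ n) := F.isLocalizedModule_syzygyMap S φ M n
  have hfr : IsFraming ι := IsFraming.of_injective hι htors
  have hfr₁ : IsFraming (localizedFraming M S (F.syzygyMap S φ hφ n) ι) :=
    hfr.localizedFraming M S (F.syzygyMap S φ hφ n)
  have happ : ∀ m, localizedFraming M S (F.syzygyMap S φ hφ n) ι (F.syzygyMap S φ hφ n m) =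
      algebraMap R S ∘ ι m :=
    localizedFraming_apply M S (F.syzygyMap S φ hφ n) ι
  refine ⟨(F.baseChange S φ hφ).d, (F.baseChange S φ hφ).ε,
    localizedFraming M S (F.syzygyMap S φ hφ n) ι, F.syzygyMap S φ hφ n,
    ⟨(F.baseChange S φ hφ).ε_surjective, (F.baseChange S φ hφ).exact_zero,
      (F.baseChange S φ hφ).exact_succ, ?_, ?_⟩, ?_, ?_⟩
  · -- injectivity: the kernel is torsion (framings localise) and `Ω₁ ⊆ S^{b n}` is torsion free
    intro m₁ m₂ h
    rw [← sub_eq_zero]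
    have h0' : localizedFraming M S (F.syzygyMap S φ hφ n) ι (m₁ - m₂) = 0 := by
      rw [map_sub, h, sub_self]
    obtain ⟨a, ha, ham⟩ := hfr₁.exists_smul_eq_zero _ h0'
    have hv : ((m₁ - m₂ : ↥((F.baseChange S φ hφ).syzygy n)) : Fin (b n) → S) = 0 :=
      eq_zero_of_smul_eq_zero_of_mem_nonZeroDivisors ha
        (by rw [← Submodule.coe_smul, ham, Submodule.coe_zero])
    exact Submodule.coe_eq_zero.mp hv
  · -- torsion cokernel
    intro z
    obtain ⟨a, ha, hmem⟩ := hfr₁.exists_smul_mem z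
    exact ⟨a, nonZeroDivisors.ne_zero ha, hmem⟩
  · -- the maximal minors of `f ∘ g` and of `g` agree in `L`
    intro g
    congr 1
    ext i j
    simp only [Matrix.of_apply]
    rw [happ, Function.comp_apply, ← IsScalarTower.algebraMap_apply]
  · -- an arbitrary `r`-tuple of `Ω₁`: clear denominators row by row
    intro g'
    choose p hp using fun i => IsLocalizedModule.surj M (F.syzygyMap S φ hφ n) (g' i)
    refine ⟨fun i => (p i).1, fun i => ((p i).2 : R), fun i => (p i).2.2, ?_⟩
    refine det_eq_det_mul_prod_inv (fun i => algebraMap R L ((p i).2 : R)) _ _ (fun i j => ?_)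
      fun i => hMK _ (p i).2.2
    simp only [Matrix.of_apply]
    have h1 := congrArg (fun v : Fin r → S => v j)
      (congrArg (localizedFraming M S (F.syzygyMap S φ hφ n) ι) (hp i))
    simp only [Submonoid.smul_def, LinearMap.map_smul_of_tower, Pi.smul_apply, happ,
      Function.comp_apply] at h1
    rw [IsScalarTower.algebraMap_apply R S L (ι (p i).1 j), ← h1, Algebra.smul_def, map_mul,
      ← IsScalarTower.algebraMap_apply]

/-! ## The registered stub -/

set_option maxHeartbeats 400000 in
/-- **STUB `stub_localizedDatum` (a minimal datum localises, given `J`-localisation).** For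
`B ⊆ O ≤ O₁` with `Frac B = K`, `B₁ := locAt O₁ B`, and `J B₁ = (J B) B₁`: a datum `(F, ι, x)`
over `B` with `x` `O`-minimal base-changes along the flat localisation `B → B₁` to a datum
`(F₁, ι₁, x₁)` over `B₁` (`FreeResolution.baseChange`, `isLocalizedModule_syzygyMap`,
`localizedFraming`) with `x₁` `O₁`-minimal, and `B₁[det ι₁ g₁ / det ι₁ x₁]` has the same
localisation at the centre of `O₁` as `B[det ι g / det ι x]`.
[cite: Matsumura1987, §19 (after Lemma 4); Villamayoru2006, 3.4] -/
theorem stub_localizedDatum : ∀ (k K : Type) [Field k] [Field K] [Algebra k K]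
    (O O₁ : ValuationSubring K) (B : Subalgebra k K), (∀ c : k, algebraMap k K c ∈ O) → O ≤ O₁ →
      B.toSubring ≤ O.toSubring → IsFractionRing ↥B K →
      singIdeal (locAt O₁ B) = (singIdeal B).map (Subalgebra.inclusion (self_le_locAt O₁ B)) →
      ∀ (b : ℕ → ℕ) (d : (i : ℕ) → ((Fin (b (i + 1)) → ↥B) →ₗ[↥B] (Fin (b i) → ↥B)))
        (ε : (Fin (b 0) → ↥B) →ₗ[↥B] (↥B ⧸ singIdeal B)) (r : ℕ)
        (ι : ↥(LinearMap.range (d (syzygyIndex k K - 1))) →ₗ[↥B] (Fin r → ↥B))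
        (x : Fin r → ↥(LinearMap.range (d (syzygyIndex k K - 1)))),
        Function.Surjective ε → Function.Exact (d 0) ε → (∀ i : ℕ, Function.Exact (d (i + 1)) (d i)) →
        Function.Injective ι → (∀ z : Fin r → ↥B, ∃ a : ↥B, a ≠ 0 ∧ a • z ∈ LinearMap.range ι) →
        Matrix.det (Matrix.of fun i j => ((ι (x i) j : ↥B) : K)) ≠ 0 →
        (∀ g' : Fin r → ↥(LinearMap.range (d (syzygyIndex k K - 1))),
          Matrix.det (Matrix.of fun i j => ((ι (g' i) j : ↥B) : K)) *
            (Matrix.det (Matrix.of fun i j => ((ι (x i) j : ↥B) : K)))⁻¹ ∈ O) →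
        ∃ (b₁ : ℕ → ℕ) (d₁ : (i : ℕ) → ((Fin (b₁ (i + 1)) → ↥(locAt O₁ B)) →ₗ[↥(locAt O₁ B)] (Fin (b₁ i) → ↥(locAt O₁ B))))
        (ε₁ : (Fin (b₁ 0) → ↥(locAt O₁ B)) →ₗ[↥(locAt O₁ B)] (↥(locAt O₁ B) ⧸ singIdeal (locAt O₁ B))) (r₁ : ℕ)
        (ι₁ : ↥(LinearMap.range (d₁ (syzygyIndex k K - 1))) →ₗ[↥(locAt O₁ B)] (Fin r₁ → ↥(locAt O₁ B)))
          (x₁ : Fin r₁ → ↥(LinearMap.range (d₁ (syzygyIndex k K - 1)))),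
          (Function.Surjective ε₁ ∧ Function.Exact (d₁ 0) ε₁ ∧ (∀ i : ℕ, Function.Exact (d₁ (i + 1)) (d₁ i)) ∧
            Function.Injective ι₁ ∧
            (∀ z : Fin r₁ → ↥(locAt O₁ B), ∃ a : ↥(locAt O₁ B), a ≠ 0 ∧ a • z ∈ LinearMap.range ι₁)) ∧
          Matrix.det (Matrix.of fun i j => ((ι₁ (x₁ i) j : ↥(locAt O₁ B)) : K)) ≠ 0 ∧
          (∀ g' : Fin r₁ → ↥(LinearMap.range (d₁ (syzygyIndex k K - 1))),
            Matrix.det (Matrix.of fun i j => ((ι₁ (g' i) j : ↥(locAt O₁ B)) : K)) *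
              (Matrix.det (Matrix.of fun i j => ((ι₁ (x₁ i) j : ↥(locAt O₁ B)) : K)))⁻¹ ∈ O₁) ∧
          locAt O₁ (Algebra.adjoin k ((locAt O₁ B : Set K) ∪
            {y : K | ∃ g : Fin r₁ → ↥(LinearMap.range (d₁ (syzygyIndex k K - 1))),
              y = Matrix.det (Matrix.of fun i j => ((ι₁ (g i) j : ↥(locAt O₁ B)) : K)) *
                (Matrix.det (Matrix.of fun i j => ((ι₁ (x₁ i) j : ↥(locAt O₁ B)) : K)))⁻¹})) =
          locAt O₁ (Algebra.adjoin k ((B : Set K) ∪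
            {y : K | ∃ g : Fin r → ↥(LinearMap.range (d (syzygyIndex k K - 1))),
              y = Matrix.det (Matrix.of fun i j => ((ι (g i) j : ↥B) : K)) *
                (Matrix.det (Matrix.of fun i j => ((ι (x i) j : ↥B) : K)))⁻¹})) := by
  intro k K _ _ _ O O₁ B hk hO hBO _hFrac hJ b d ε r ι x hε h0 hs hι htors hx hmin
  -- standing inclusions
  have hB₁ : B.toSubring ≤ O₁.toSubring := fun y hy => hO (hBO hy)
  have hle : B ≤ locAt O₁ B := self_le_locAt O₁ B
  have hL₁ : (locAt O₁ B).toSubring ≤ O₁.toSubring := locAt_le O₁ B hB₁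
  have hk₁ : ∀ c : k, algebraMap k K c ∈ O₁ := fun c => hO (hk c)
  -- (0) `B₁ = locAt O₁ B` as a `B`-algebra (the inclusion) and as the localisation at `M`
  letI : Algebra ↥B ↥(locAt O₁ B) := (Subalgebra.inclusion hle).toRingHom.toAlgebra
  haveI : IsScalarTower ↥B ↥(locAt O₁ B) K := IsScalarTower.of_algebraMap_eq fun _ => rfl
  set M : Submonoid ↥B :=
    (IsUnit.submonoid ↥(locAt O₁ B)).comap (algebraMap ↥B ↥(locAt O₁ B)) with hMdef
  have hmemM : ∀ s : ↥B, s ∈ M ↔ IsUnit (algebraMap ↥B ↥(locAt O₁ B) s) := fun _ => Iff.rfl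
  haveI : IsLocalization M ↥(locAt O₁ B) :=
    { map_units := fun s => (hmemM s.1).mp s.2
      surj := fun y => by
        obtain ⟨a, ha, s, hs, hv, hy⟩ := (mem_locAt_iff O₁ B hB₁).mp y.2
        have hs0 : s ≠ 0 := ne_zero_of_valuation_eq_one hv
        have hsM : (⟨s, hs⟩ : ↥B) ∈ M := (hmemM _).mpr
          (IsUnit.of_mul_eq_one (⟨s⁻¹, inv_mem_locAt O₁ B hB₁ (hle hs) hv⟩ : ↥(locAt O₁ B))
            (Subtype.ext (mul_inv_cancel₀ hs0)))
        refine ⟨(⟨a, ha⟩, ⟨⟨s, hs⟩, hsM⟩), Subtype.ext ?_⟩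
        show (y : K) * s = a
        rw [hy, inv_mul_cancel_right₀ hs0]
      exists_of_eq := fun {a₁ a₂} h => ⟨1, by
        have h' : a₁ = a₂ := Subtype.ext (congrArg (fun t : ↥(locAt O₁ B) => (t : K)) h)
        rw [h']⟩ }
  -- elements of `M` are nonzero in `K`, and their inverses lie in `B₁ ⊆ O₁`
  have hMK : ∀ s ∈ M, algebraMap ↥B K s ≠ 0 := fun s hs =>
    (((hmemM s).mp hs).map (algebraMap ↥(locAt O₁ B) K)).ne_zero
  have hMinv : ∀ s ∈ M, ((s : ↥B) : K)⁻¹ ∈ locAt O₁ B := fun s hs => by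
    obtain ⟨u, hu⟩ := (hmemM s).mp hs
    have h1 : (((u⁻¹ : (↥(locAt O₁ B))ˣ) : ↥(locAt O₁ B)) : K) * (s : K) = 1 := by
      have h2 := congrArg (fun t : ↥(locAt O₁ B) => (t : K)) u.inv_mul
      simp only [hu, Subalgebra.coe_mul, Subalgebra.coe_one] at h2
      exact h2
    rw [← eq_inv_of_mul_eq_one_left h1]
    exact ((u⁻¹ : (↥(locAt O₁ B))ˣ) : ↥(locAt O₁ B)).2
  -- the hypothesis `J B₁ = (J B) B₁` along `algebraMap = inclusion`
  have hJ' : singIdeal (locAt O₁ B) = (singIdeal B).map (algebraMap ↥B ↥(locAt O₁ B)) := hJ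
  -- (1)–(5): the algebraic construction over `B → B₁`, read in `K`
  obtain ⟨d₁, ε₁, ι₁, f, hfive, hdetf, hdetg⟩ :=
    localizedDatum_alg M hMK (singIdeal B) (singIdeal (locAt O₁ B)) hJ' (syzygyIndex k K - 1)
      b d ε r ι hε h0 hs hι htors
  have hdetf' : ∀ g : Fin r → ↥(LinearMap.range (d (syzygyIndex k K - 1))),
      Matrix.det (Matrix.of fun i j => ((ι₁ (f (g i)) j : ↥(locAt O₁ B)) : K)) =
        Matrix.det (Matrix.of fun i j => ((ι (g i) j : ↥B) : K)) := hdetf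
  have hdetg' : ∀ g' : Fin r → ↥(LinearMap.range (d₁ (syzygyIndex k K - 1))),
      ∃ (m : Fin r → ↥(LinearMap.range (d (syzygyIndex k K - 1)))) (s : Fin r → ↥B),
        (∀ i, s i ∈ M) ∧
        Matrix.det (Matrix.of fun i j => ((ι₁ (g' i) j : ↥(locAt O₁ B)) : K)) =
          Matrix.det (Matrix.of fun i j => ((ι (m i) j : ↥B) : K)) *
            (∏ i, ((s i : ↥B) : K))⁻¹ := hdetg
  have hprodinv : ∀ s : Fin r → ↥B, (∀ i, s i ∈ M) →
      (∏ i, ((s i : ↥B) : K))⁻¹ ∈ locAt O₁ B := fun s hsM => by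
    rw [← Finset.prod_inv_distrib]
    exact prod_mem fun i _ => hMinv (s i) (hsM i)
  refine ⟨b, d₁, ε₁, r, ι₁, fun i => f (x i), hfive, ?_, ?_, ?_⟩
  · -- `det (ι₁ x₁) = det (ι x) ≠ 0`
    rw [hdetf' x]
    exact hx
  · -- `O₁`-minimality of `x₁`
    intro g'
    obtain ⟨m, s, hsM, hdet⟩ := hdetg' g'
    rw [hdet, hdetf' x]
    have hmem := mul_mem (hO (hmin m)) (hL₁ (hprodinv s hsM))
    rwa [mul_right_comm] at hmem
  · -- the two charts have the same localisation at the centre of `O₁`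
    refine locAt_adjoin_union_eq O₁ hk₁ hle le_rfl hB₁ ?_ ?_ ?_
    · rintro _ ⟨g, rfl⟩
      exact hO (hmin g)
    · rintro _ ⟨g, rfl⟩
      exact ⟨fun i => f (g i), by rw [hdetf' g, hdetf' x]⟩
    · rintro _ ⟨g', rfl⟩
      obtain ⟨m, s, hsM, hdet⟩ := hdetg' g'
      exact ⟨_, ⟨m, rfl⟩, _, hprodinv s hsM, by rw [hdet, hdetf' x, mul_right_comm]⟩

end Summit.ResolutionOfSingularities.ResolutionOfSingularities.Theorems.SyzygyFlattening

end
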